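import Literature.NumberTheory.GaloisRepresentations.HeckeCharacter
import HarnessLib

/-!
# Existence of Hecke characters with prescribed (unitary) archimedean components
# (Weil 1956; Patrikis, *Variations on a theorem of Tate*, Lemma 2.1.1)

One NAMED FACT (D-0014: `def … : Prop`, nothing proved).

Printed statement (Patrikis 2019 = arXiv:1207.6724, §2.1, Lemma 2.1.1, crediting Weil 1956): every
Hecke character `ψ : 𝔸_Fˣ/Fˣ → ℂˣ` is `|·|^r` times a unitary one; at `v ∣ ∞` a unitary `ψ_v` is, in
terms of an embedding `ι_v : F_v ↪ ℂ`, `ψ_v(x_v) = (ι_v(x_v)/|ι_v(x_v)|)^{m_v} |ι_v(x_v)|^{i t_v}` with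
`m_v ∈ ℤ`, `t_v ∈ ℝ`.  "**Lemma 2.1.1.** There is a (unitary, say) Hecke character `ψ` of `F` with
archimedean parameters `{m_v, t_v}_{v ∣ ∞}`, as above, if and only if for some positive integer `M`,
all global units `α ∈ 𝓞_Fˣ` satisfy `(∏_{v ∣ ∞} (ι_v(α)/|ι_v(α)|)^{m_v} |ι_v(α)|^{i t_v})^M = 1`.
Equivalently, the inside product is trivial for all `α` in some finite-index subgroup of `𝓞_Fˣ`."

Typing (vocabulary of `HeckeCharacter.lean`): the archimedean part of `χ : HeckeCharacter K` is
`x ↦ χ (infiniteIdeles K x)` on `x ∈ (K ⊗ ℝ)ˣ = (InfiniteAdeleRing K)ˣ`; the embedding `ι_w` of the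
completion at `w` is Mathlib's `NumberField.InfinitePlace.Completion.extensionEmbedding w`, whose
restriction to `K` is `w.embedding` (`extensionEmbedding_coe`), so the unit-side product is written
with `w.embedding`.  "`ψ` has archimedean parameters `(m, t)`" is the identity
`χ((x, 1)) = ∏_w (ι_w(x_w)/|ι_w(x_w)|)^{m_w} |ι_w(x_w)|^{i t_w}` for ALL infinite ideles `x` (the
product of the local components).  Unitarity of `ψ` is then automatic (a Hecke character is
`|·|^r ×` unitary and `|·|^r` is already non-unitary on `(K ⊗ ℝ)ˣ` for `r ≠ 0`), so it is not
repeated on the left.  `|z|^{i t}` is the principal complex power `(‖z‖ : ℂ) ^ (t·I)` (`‖z‖ > 0`).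
At a real place `(ι(x)/|ι(x)|)^{m} = sgn(x)^m`, as in the source.  The normalisation of `|·|` at
complex places (Patrikis writes `|·|_ℂ` in the display before the lemma and `|·|` inside it) only
rescales `t_v`, and the SAME convention is used on both sides here.

Why here: the archimedean re-twisting step of
`Summit.Langlands.Langlands.Theses.IrreducibilityBySelfDuality.RegularTwistCM` (stmt-Langlands-14069:
a character of `K_∞ˣ` killing a finite-index subgroup of the units of the CM field `K` IS the
infinite component of a Hecke character); companion of `Chevalley1951.thm1_units`
(`Literature/NumberTheory/NumberFields/ChevalleyUnitCongruence.lean`), which turns "finite-index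
subgroup of units" into "congruence subgroup of units".  A prover takes it as a hypothesis
`(h : HeckeCharacter.exists_of_unitaryArchParams_iff)`.
-/

noncomputable section

open scoped NumberField
open NumberField NumberField.InfinitePlace NumberField.InfinitePlace.Completion

namespace Literature.NumberTheory.GaloisRepresentations

universe u

variable {K : Type u} [Field K] [NumberField K]

/-- The **unitary archimedean character with parameters `(m, t)`** on the infinite ideles:
`x ↦ ∏_{w ∣ ∞} (ι_w(x_w)/|ι_w(x_w)|)^{m_w} · |ι_w(x_w)|^{i t_w}` (`m_w ∈ ℤ`, `t_w ∈ ℝ`; Patrikis §2.1,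
display before Lemma 2.1.1).  A plain function; every unitary character of `(K ⊗ ℝ)ˣ` has this
form. [cite: Patrikis2019, §2.1 (display before Lemma 2.1.1)] -/
def InfiniteIdele.unitaryArchChar (m : InfinitePlace K → ℤ) (t : InfinitePlace K → ℝ)
    (x : (InfiniteAdeleRing K)ˣ) : ℂ :=
  ∏ w : InfinitePlace K,
    (extensionEmbedding w ((x : InfiniteAdeleRing K) w) /
        (‖extensionEmbedding w ((x : InfiniteAdeleRing K) w)‖ : ℂ)) ^ (m w) *
      ((‖extensionEmbedding w ((x : InfiniteAdeleRing K) w)‖ : ℂ) ^ ((t w : ℂ) * Complex.I))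

variable (K) in
/-- The same product evaluated on a global unit `α ∈ 𝓞_Kˣ` through the embeddings `ι_w = w.embedding`:
`∏_{w ∣ ∞} (ι_w(α)/|ι_w(α)|)^{m_w} |ι_w(α)|^{i t_w}` (the "inside product" of Lemma 2.1.1).
[cite: Patrikis2019, Lemma 2.1.1] -/
def unitArchProduct (m : InfinitePlace K → ℤ) (t : InfinitePlace K → ℝ) (α : (𝓞 K)ˣ) : ℂ :=
  ∏ w : InfinitePlace K,
    (w.embedding ((α : 𝓞 K) : K) / (‖w.embedding ((α : 𝓞 K) : K)‖ : ℂ)) ^ (m w) *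
      ((‖w.embedding ((α : 𝓞 K) : K)‖ : ℂ) ^ ((t w : ℂ) * Complex.I))

/-- **Weil 1956 / Patrikis 2019, Lemma 2.1.1 (existence of Hecke characters with prescribed unitary
archimedean parameters).**  For a number field `K` and parameters `m : (w ∣ ∞) → ℤ`, `t : (w ∣ ∞) → ℝ`:
there is a Hecke character `χ` of `K` whose archimedean part is
`χ((x,1)) = ∏_w (ι_w(x_w)/|ι_w(x_w)|)^{m_w} |ι_w(x_w)|^{i t_w}` for every infinite idele `x`
**if and only if** for some integer `M > 0` every global unit `α ∈ 𝓞_Kˣ` satisfies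
`(∏_w (ι_w(α)/|ι_w(α)|)^{m_w} |ι_w(α)|^{i t_w})^M = 1` (equivalently: the product is `1` on a
finite-index subgroup of `𝓞_Kˣ`).
Grounds `Summit.Langlands.Langlands.Theses.IrreducibilityBySelfDuality.RegularTwistCM` (as a
hypothesis). [cite: Patrikis2019, Lemma 2.1.1] [cite: Weil1956, §1] -/
def HeckeCharacter.exists_of_unitaryArchParams_iff : Prop :=
  ∀ (K : Type) [Field K] [NumberField K] (m : InfinitePlace K → ℤ) (t : InfinitePlace K → ℝ),
    (∃ χ : HeckeCharacter K, ∀ x : (InfiniteAdeleRing K)ˣ,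
        (χ (infiniteIdeles K x) : ℂ) = InfiniteIdele.unitaryArchChar m t x) ↔
      ∃ M : ℕ, 0 < M ∧ ∀ α : (𝓞 K)ˣ, unitArchProduct K m t α ^ M = 1

end Literature.NumberTheory.GaloisRepresentations
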